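/-
Copyright (c) 2026. All rights reserved.
Released under Apache 2.0 license as described in the file LICENSE.
Authors: abc-iut cell, statement-typer seat abc-iut-L4-t3 (wave 1).
-/
import Literature.AnabelianGeometry.AbsoluteAnabelian.LogFrobeniusContactStructure
import Literature.AnabelianGeometry.AbsoluteAnabelian.LogFrobeniusTelecoreProofs

/-!
# [AbsTopIII] Corollary 5.5 (ii) DISCHARGED with the contact structure pinned: `Cor55TelecoreContact`

S. Mochizuki, *Topics in absolute anabelian geometry III: global reconstruction algorithms*,
J. Math. Sci. Univ. Tokyo 22 (2015) 939–1156 [MochizukiAbsTopIII2015]; locators `p.N` = pages of the author's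
manuscript (`paper:url-5493eb38cbb7`), read on the page: Cor 5.5 (ii) pp. 130–131, proof p. 132 l. 22–23
("Assertions (i), (ii) are immediate from the definitions").

Continuation of `LogFrobeniusContactStructure.lean` (structure functors of `D_{An•}` over `𝒳`, the universal family
`K`, the contact structure `ℋ_{An•}` = `K` restricted to the saturation of the printed generating pairs).  Here:

* the homotopies of `ℋ_{An•}` on the printed generators are COMPUTED (`contactFamily_etaSq`, `contactFamily_etaCore`,
  `contactFamily_etaRow`): they are lifts through the identity structure functor at `□` / `𝒳_⋎` (t5's
  `DiagramLifts`), i.e. `pathIso γ₁ ∘ pathIso γ₂⁻¹`, and the `pathIso` along the generator paths are unwound edge by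
  edge (`μ` = unitors / `Iso.refl` / associators / `lamOver ≫ η_{An•}`), the `eqToHom` bookkeeping being done
  heterogeneously (method of t5's `AbsTopIII/FrobeniusPictureMLFTelecoreProofs.lean`, Cor 3.6 (ii)) — `η_{□⋎}` IS the
  identity and `η_⋏` IS "the isomorphism arising from `η_{An•}`", `φ_{An•}(κ_{An•}(λ⊞ lies over Th•[Z])) ≫ η_{An•}`,
  componentwise, as `IsAnContactGenerated` demands;
* the telecore `𝔗_{An•}` = t5's `univTelecore` for the fully faithful vertex set `{An•[𝒳], □, 𝒳_⋎}`
  (`contactTelecore`; `V(F_mod) ≠ ∅` makes every vertex reach `An•[𝒳]`, abc-iut-L4-t15's `reach_an`), for which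
  `ℋ_{An•}` is a contact structure (`isContactStructure_restrictBoundary`);
* **`cor55TelecoreContact_holds : L.Cor55TelecoreContact`** for every `L` with `V(F_mod) ≠ ∅`, and
  `cor55TelecoreContact_iff_nonempty` (necessity: t15's `not_cor55Telecore_of_isEmpty` via `cor55Telecore_of_contact`).

Refereed pre-IUT material; OUR kernel check of a typed statement; nothing here bears on [IUTchIII] Cor. 3.12.
-/

set_option autoImplicit false

universe u

open CategoryTheory Quiver

namespace Literature.AnabelianGeometry.AbsoluteAnabelian

namespace LogFrobeniusSetting

open DiagramOfCategories

variable {Vmod : Type u} {isArc : Vmod → Bool} (L : LogFrobeniusSetting Vmod isArc)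

section Generators

variable (vc : Vmod) (νc : LogVertex (isArc vc)) (hνc : νc.isPostLog = false)
  (vr : ℤ → Vmod) (νr : ∀ n, LogVertex (isArc (vr n))) (hνr : ∀ n, (νr n).isPostLog = false)

/-! ## The homotopies of `ℋ_{An•}` on the generators -/

/-- The homotopy of `ℋ_{An•}` on a pair into a vertex of `contactW` is the lift there. [folklore] -/
private theorem contactFamily_η_eq_lift {a w : (anTelecoreShape (Vmod := Vmod) (isArc := isArc) anTelJ).Vertex}
    (hw : contactW w) (p q : Path a w) (h : (L.contactFamily vc νc hνc vr νr hνr).E p q) :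
    (L.contactFamily vc νc hνc vr νr hνr).η h = (L.contactOver).lift (L.contactFF w hw) p q :=
  teleUnivFamily_η_eq_lift _ _ _ _ _ _ _ _ contactW L.contactFF hw p q _

/-- `μ` on the telecore edge `φ_□` is the unitor (definitional unfolding). [folklore] -/
private theorem contactOver_μ_phiCore (jc : anTelJ (isArc := isArc) ⟨.core, core_mem_five⟩) :
    (L.contactOver).μ (a := (anTelecoreShape (isArc := isArc) anTelJ).obs)
      (b := (anTelecoreShape anTelJ).base ⟨.core, core_mem_five⟩) jc = L.φAn.rightUnitor := rfl

/-- `μ` on the telecore edge `φ_⋎` is the unitor (definitional unfolding). [folklore] -/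
private theorem contactOver_μ_phiRow (n : ℤ) (jn : anTelJ (isArc := isArc) ⟨.row1 n, row1_mem_five n⟩) :
    (L.contactOver).μ (a := (anTelecoreShape (isArc := isArc) anTelJ).obs)
      (b := (anTelecoreShape anTelJ).base ⟨.row1 n, row1_mem_five n⟩) jn = L.φAn.rightUnitor := rfl

/-- `μ` on `id_⋎` is the unitor (definitional unfolding). [folklore] -/
private theorem contactOver_μ_toCore (n : ℤ) :
    (L.contactOver).μ (show (anTelecoreShape (isArc := isArc) anTelJ).base ⟨.row1 n, row1_mem_five n⟩ ⟶
        (anTelecoreShape anTelJ).base ⟨.core, core_mem_five⟩ from DEdge.toCore n) = (𝟭 L.X).leftUnitor := rfl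

/-- `μ` on `λ⊞_{v,ν}` is `lamOver ▷ (κ_{An•} ⋙ φ_{An•})` followed by `η_{An•}` (definitional unfolding). [folklore] -/
private theorem contactOver_μ_lam (v : Vmod) (ν : LogVertex (isArc v)) (hν : ν.isPostLog = false) :
    (L.contactOver).μ (show (anTelecoreShape (isArc := isArc) anTelJ).base ⟨.core, core_mem_five⟩ ⟶
        (anTelecoreShape anTelJ).base ⟨.nplus v, nplus_mem_five v⟩ from DEdge.lam v ν hν) =
      (Functor.associator _ _ _).symm ≪≫ Functor.isoWhiskerRight (L.lamOver v ν) (L.κAn.functor ⋙ L.φAn) ≪≫ L.ηAn :=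
  rfl

/-- `μ` on `𝒩⊞_v → 𝒩_v` is an associator (definitional unfolding). [folklore] -/
private theorem contactOver_μ_forget (v : Vmod) :
    (L.contactOver).μ (show (anTelecoreShape (isArc := isArc) anTelJ).base ⟨.nplus v, nplus_mem_five v⟩ ⟶
        (anTelecoreShape anTelJ).base ⟨.nv v, nv_mem_five v⟩ from DEdge.forget v) = (Functor.associator _ _ _).symm :=
  rfl

/-- `μ` on `𝒩_v → ℰ•` is the identity (definitional unfolding). [folklore] -/
private theorem contactOver_μ_toE (v : Vmod) :
    (L.contactOver).μ (show (anTelecoreShape (isArc := isArc) anTelJ).base ⟨.nv v, nv_mem_five v⟩ ⟶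
        (anTelecoreShape anTelJ).base ⟨.e5, e5_mem_five⟩ from DEdge.toE v) = Iso.refl _ :=
  rfl

/-- `μ` on the observation edge `κ_{An•}` is the identity (definitional unfolding). [folklore] -/
private theorem contactOver_μ_κAn :
    (L.contactOver).μ (show (anTelecoreShape (isArc := isArc) anTelJ).base ⟨.e5, e5_mem_five⟩ ⟶
        (anTelecoreShape anTelJ).obs from DEdge.κAn) = Iso.refl _ :=
  rfl

/-- `eqToHom`s are heterogeneously identities (bookkeeping). [folklore] -/
private theorem eqToHom_heq_id {C : Type (u + 1)} [Category.{u} C] {X Y Z : C} (r : X = Z) (h : Z = Y) :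
    eqToHom r ≍ 𝟙 Y := by
  subst r h; simp

/-- A morphism heterogeneously equal to an identity is an `eqToHom` (bookkeeping). [folklore] -/
private theorem eq_eqToHom_of_heq {C : Type (u + 1)} [Category.{u} C] {x y z : C} {f : x ⟶ y} (hx : x = z)
    (hy : y = z) (h : f ≍ 𝟙 z) : f = eqToHom (hx.trans hy.symm) := by
  subst hx hy
  simpa using h

/-- Stripping a leading identity under `≍` (bookkeeping). [folklore] -/
private theorem id_comp_heq_iff {C : Type (u + 1)} [Category.{u} C] {X Y X' Y' : C} (f : X ⟶ Y)
    (g : X' ⟶ Y') : 𝟙 X ≫ f ≍ g ↔ f ≍ g := by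
  rw [Category.id_comp]

/-- Reassociating under `≍` (bookkeeping). [folklore] -/
private theorem assoc_heq_iff {C : Type (u + 1)} [Category.{u} C] {V W X Y X' Y' : C} (f : V ⟶ W)
    (g : W ⟶ X) (k : X ⟶ Y) (l : X' ⟶ Y') : (f ≫ g) ≫ k ≍ l ↔ f ≫ g ≫ k ≍ l := by
  rw [Category.assoc]

/-- The inverse of an isomorphism is determined heterogeneously by its hom part (bookkeeping). [folklore] -/
private theorem iso_inv_heq {C : Type (u + 1)} [Category.{u} C] {X Y X' Y' : C} (i : X ≅ Y) (i' : X' ≅ Y')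
    (hX : X = X') (hY : Y = Y') (h : i.hom ≍ i'.hom) : i.inv ≍ i'.inv := by
  subst hX hY
  obtain rfl : i = i' := Iso.ext (eq_of_heq h)
  rfl

/-- The printed homotopy `η_⋏` "arising from `η_{An•}`", at equal objects (bookkeeping). [folklore] -/
private theorem lamEta_heq (v : Vmod) (ν : LogVertex (isArc v)) {y y' : L.X} (h : y = y') :
    L.φAn.map (L.κAn.functor.map ((L.lamOver v ν).hom.app y)) ≫ L.ηAn.hom.app y ≍
      L.φAn.map (L.κAn.functor.map ((L.lamOver v ν).hom.app y')) ≫ L.ηAn.hom.app y' := by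
  subst h; rfl

/-- `pathIso` of the empty path is the identity, inverse component (bookkeeping). [folklore] -/
private theorem pathIso_nil_inv_heq {w : (anTelecoreShape (Vmod := Vmod) (isArc := isArc) anTelJ).Vertex}
    (x : (L.anTelecoreDiagram anTelJ (fun {a} j => L.telecoreFun a.1 j)).obj w) :
    ((L.contactOver).pathIso (Path.nil : Path w w)).inv.app x ≍ 𝟙 (((L.contactOver).N w).obj x) := by
  erw [OverData.pathIso, eqToIso.inv, eqToHom_app]
  exact eqToHom_heq_id _ (congrArg ((L.contactOver).N w).obj
    (Functor.congr_obj ((L.anTelecoreDiagram anTelJ (fun {a} j => L.telecoreFun a.1 j)).pathFunctor_nil w) x))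

/-- `pathIso [φ_□]` is the identity. [folklore] -/
private theorem pathIso_phiCore_heq (jc : anTelJ (isArc := isArc) ⟨.core, core_mem_five⟩) (a : L.An) :
    ((L.contactOver).pathIso (phiCorePath anTelJ jc)).hom.app a ≍ 𝟙 (L.φAn.obj a) := by
  erw [phiCorePath, OverData.pathIso_cons_app, OverData.pathIso_nil_app, contactOver_μ_phiCore]
  refine (eqToHom_comp_heq_iff _ _ _).2 ((id_comp_heq_iff _ _).2 ?_)
  exact eqToHom_heq_id _ rfl

/-- `pathIso ([id_⋎] ∘ [φ_⋎])` is the identity. [folklore] -/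
private theorem pathIso_phiRow_heq (n : ℤ) (jn : anTelJ (isArc := isArc) ⟨.row1 n, row1_mem_five n⟩) (a : L.An) :
    ((L.contactOver).pathIso (phiRowPath anTelJ n jn)).hom.app a ≍ 𝟙 (L.φAn.obj a) := by
  erw [phiRowPath, OverData.pathIso_cons_app, OverData.pathIso_cons_app, OverData.pathIso_nil_app,
    contactOver_μ_toCore, contactOver_μ_phiRow]
  refine (eqToHom_comp_heq_iff _ _ _).2 ((id_comp_heq_iff _ _).2
    ((eqToHom_comp_heq_iff _ _ _).2 ((id_comp_heq_iff _ _).2 ?_)))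
  exact eqToHom_heq_id _ rfl

/-- `pathIso [β¹_□]` is the printed `η_□`: `φ_{An•}(κ_{An•}(λ⊞ lies over Th•[Z])) ≫ η_{An•}`. [folklore] -/
private theorem pathIso_betaCore_heq (jc : anTelJ (isArc := isArc) ⟨.core, core_mem_five⟩) (x : L.X) :
    ((L.contactOver).pathIso (betaCorePath anTelJ vc νc hνc jc)).hom.app x ≍
      L.φAn.map (L.κAn.functor.map ((L.lamOver vc νc).hom.app x)) ≫ L.ηAn.hom.app x := by
  erw [betaCorePath, descendPath, OverData.pathIso_cons_app, OverData.pathIso_cons_app, OverData.pathIso_cons_app,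
    OverData.pathIso_cons_app, OverData.pathIso_cons_app, OverData.pathIso_nil_app, contactOver_μ_phiCore,
    contactOver_μ_κAn, contactOver_μ_toE, contactOver_μ_forget, contactOver_μ_lam]
  refine (eqToHom_comp_heq_iff _ _ _).2 ((id_comp_heq_iff _ _).2
    ((eqToHom_comp_heq_iff _ _ _).2 ((id_comp_heq_iff _ _).2
    ((eqToHom_comp_heq_iff _ _ _).2 ((id_comp_heq_iff _ _).2
    ((eqToHom_comp_heq_iff _ _ _).2 ((id_comp_heq_iff _ _).2
    ((eqToHom_comp_heq_iff _ _ _).2 ((comp_eqToHom_heq_iff _ _ _).2 ?_)))))))))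
  erw [Iso.trans_hom, Iso.trans_hom, NatTrans.comp_app, NatTrans.comp_app, Functor.isoWhiskerRight_hom,
    Functor.whiskerRight_app]
  refine (id_comp_heq_iff _ _).2 ?_
  exact L.lamEta_heq vc νc (Functor.congr_obj ((L.anTelecoreDiagram anTelJ (fun {a} j => L.telecoreFun a.1 j)).pathFunctor_nil
    ((anTelecoreShape anTelJ).base ⟨.core, core_mem_five⟩)) x)

/-- `[β¹_⋎]` spelled out as a path of length `6`. [folklore] -/
private theorem betaRowPath_eq (n : ℤ) (v : Vmod) (ν : LogVertex (isArc v)) (hν : ν.isPostLog = false)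
    (jn : anTelJ (isArc := isArc) ⟨.row1 n, row1_mem_five n⟩) :
    betaRowPath anTelJ n v ν hν jn =
      ((((((Path.nil : Path ((anTelecoreShape (isArc := isArc) anTelJ).base ⟨.row1 n, row1_mem_five n⟩) _).cons
        (show (anTelecoreShape (isArc := isArc) anTelJ).base ⟨.row1 n, row1_mem_five n⟩ ⟶
          (anTelecoreShape anTelJ).base ⟨.core, core_mem_five⟩ from DEdge.toCore n)).cons
        (show (anTelecoreShape (isArc := isArc) anTelJ).base ⟨.core, core_mem_five⟩ ⟶
          (anTelecoreShape anTelJ).base ⟨.nplus v, nplus_mem_five v⟩ from DEdge.lam v ν hν)).cons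
        (show (anTelecoreShape (isArc := isArc) anTelJ).base ⟨.nplus v, nplus_mem_five v⟩ ⟶
          (anTelecoreShape anTelJ).base ⟨.nv v, nv_mem_five v⟩ from DEdge.forget v)).cons
        (show (anTelecoreShape (isArc := isArc) anTelJ).base ⟨.nv v, nv_mem_five v⟩ ⟶
          (anTelecoreShape anTelJ).base ⟨.e5, e5_mem_five⟩ from DEdge.toE v)).cons
        (show (anTelecoreShape (isArc := isArc) anTelJ).base ⟨.e5, e5_mem_five⟩ ⟶ (anTelecoreShape anTelJ).obs
          from DEdge.κAn)).cons jn :=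
  rfl

/-- `pathIso [β¹_⋎]` is the printed `η_⋎`: `φ_{An•}(κ_{An•}(λ⊞ lies over Th•[Z])) ≫ η_{An•}`. [folklore] -/
private theorem pathIso_betaRow_heq (n : ℤ) (jn : anTelJ (isArc := isArc) ⟨.row1 n, row1_mem_five n⟩) (x : L.X) :
    ((L.contactOver).pathIso (betaRowPath anTelJ n (vr n) (νr n) (hνr n) jn)).hom.app x ≍
      L.φAn.map (L.κAn.functor.map ((L.lamOver (vr n) (νr n)).hom.app x)) ≫ L.ηAn.hom.app x := by
  rw [betaRowPath_eq]
  erw [OverData.pathIso_cons_app, OverData.pathIso_cons_app, OverData.pathIso_cons_app,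
    OverData.pathIso_cons_app, OverData.pathIso_cons_app, OverData.pathIso_cons_app, OverData.pathIso_nil_app,
    contactOver_μ_phiRow, contactOver_μ_κAn, contactOver_μ_toE, contactOver_μ_forget, contactOver_μ_lam,
    contactOver_μ_toCore]
  refine (eqToHom_comp_heq_iff _ _ _).2 ((id_comp_heq_iff _ _).2
    ((eqToHom_comp_heq_iff _ _ _).2 ((id_comp_heq_iff _ _).2
    ((eqToHom_comp_heq_iff _ _ _).2 ((id_comp_heq_iff _ _).2
    ((eqToHom_comp_heq_iff _ _ _).2 ((id_comp_heq_iff _ _).2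
    ((eqToHom_comp_heq_iff _ _ _).2 ?_))))))))
  erw [Iso.trans_hom, Iso.trans_hom, NatTrans.comp_app, NatTrans.comp_app, Functor.isoWhiskerRight_hom,
    Functor.whiskerRight_app]
  refine (assoc_heq_iff _ _ _ _).2 ((id_comp_heq_iff _ _).2 ?_)
  have hy : ((L.anTelecoreDiagram anTelJ (fun {a} j => L.telecoreFun a.1 j)).pathFunctor
      ((Path.nil : Path ((anTelecoreShape (isArc := isArc) anTelJ).base ⟨.row1 n, row1_mem_five n⟩) _).cons
        (show (anTelecoreShape (isArc := isArc) anTelJ).base ⟨.row1 n, row1_mem_five n⟩ ⟶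
          (anTelecoreShape anTelJ).base ⟨.core, core_mem_five⟩ from DEdge.toCore n))).obj x = x := by
    simp only [pathFunctor_cons, pathFunctor_nil]
    rfl
  refine HEq.trans ?_ (heq_of_eq (Category.comp_id _))
  refine heq_comp (by rw [hy]; rfl) (by rw [hy]; rfl) rfl (L.lamEta_heq (vr n) (νr n) hy) ?_
  refine (eqToHom_comp_heq_iff _ _ _).2 ((id_comp_heq_iff _ _).2 ?_)
  exact eqToHom_heq_id _ rfl

/-- **`η_{□⋎}` is the identity**: the homotopy of `ℋ_{An•}` on the generator `([φ_□], [id_⋎] ∘ [φ_⋎])` ("we write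
`η_{□⋎}` for the identity natural transformation from the arrow `φ_□` to the composite arrow `id_⋎ ∘ φ_⋎`").
[cite: MochizukiAbsTopIII2015, Cor 5.5 (ii) p.131] -/
theorem contactFamily_etaSq (n : ℤ) (jc : anTelJ (isArc := isArc) ⟨.core, core_mem_five⟩)
    (jn : anTelJ (isArc := isArc) ⟨.row1 n, row1_mem_five n⟩)
    (h : (L.contactFamily vc νc hνc vr νr hνr).E (phiCorePath anTelJ jc) (phiRowPath anTelJ n jn)) (a : L.An) :
    ∃ e, ((L.contactFamily vc νc hνc vr νr hνr).η h).app a = eqToHom e := by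
  have e₁ : ((L.anTelecoreDiagram anTelJ (fun {a} j => L.telecoreFun a.1 j)).pathFunctor (phiCorePath anTelJ jc)).obj a =
      L.φAn.obj a := by
    simp only [phiCorePath, pathFunctor_cons, pathFunctor_nil]; rfl
  have e₂ : ((L.anTelecoreDiagram anTelJ (fun {a} j => L.telecoreFun a.1 j)).pathFunctor (phiRowPath anTelJ n jn)).obj a =
      L.φAn.obj a := by
    simp only [phiRowPath, pathFunctor_cons, pathFunctor_nil]; rfl
  refine ⟨e₁.trans e₂.symm, ?_⟩
  rw [L.contactFamily_η_eq_lift vc νc hνc vr νr hνr (w := (anTelecoreShape anTelJ).base ⟨.core, core_mem_five⟩) trivial]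
  have key : ((L.contactOver).lift (L.contactFF ((anTelecoreShape anTelJ).base ⟨.core, core_mem_five⟩) trivial)
      (phiCorePath anTelJ jc) (phiRowPath anTelJ n jn)).app a =
      ((L.contactOver).pathIso (phiCorePath anTelJ jc)).hom.app a ≫
        ((L.contactOver).pathIso (phiRowPath anTelJ n jn)).inv.app a :=
    (L.contactOver).map_lift_app (L.contactFF ((anTelecoreShape anTelJ).base ⟨.core, core_mem_five⟩) trivial)
      (phiCorePath anTelJ jc) (phiRowPath anTelJ n jn) a
  rw [key]
  refine eq_eqToHom_of_heq e₁ e₂ ?_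
  refine HEq.trans ?_ (heq_of_eq (Category.id_comp (𝟙 (L.φAn.obj a))))
  exact heq_comp e₁ rfl e₂ (L.pathIso_phiCore_heq jc a)
    (iso_inv_heq (((L.contactOver).pathIso (phiRowPath anTelJ n jn)).app a) (Iso.refl (L.φAn.obj a)) e₂ rfl
      (L.pathIso_phiRow_heq n jn a))

/-- **`η_□` arises from `η_{An•}`**: the homotopy of `ℋ_{An•}` on the generator `([β¹_□], [β⁰_□])` is, componentwise,
`φ_{An•}(κ_{An•}(λ⊞_{v,ν} lies over Th•[Z])) ≫ η_{An•}`. [cite: MochizukiAbsTopIII2015, Cor 5.5 (ii) p.131] -/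
theorem contactFamily_etaCore (jc : anTelJ (isArc := isArc) ⟨.core, core_mem_five⟩)
    (h : (L.contactFamily vc νc hνc vr νr hνr).E (betaCorePath anTelJ vc νc hνc jc) Path.nil) (x : L.X) :
    ∃ (h₁ : ((L.anTelecoreDiagram anTelJ (fun {a} j => L.telecoreFun a.1 j)).pathFunctor
          (betaCorePath anTelJ vc νc hνc jc)).obj x =
          L.φAn.obj (L.κAn.functor.obj ((L.lam vc νc ⋙ L.forget vc ⋙ L.toE vc).obj x)))
      (h₂ : x = ((L.anTelecoreDiagram anTelJ (fun {a} j => L.telecoreFun a.1 j)).pathFunctor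
          (Path.nil : Path ((anTelecoreShape anTelJ).base ⟨.core, core_mem_five⟩) _)).obj x),
      ((L.contactFamily vc νc hνc vr νr hνr).η h).app x =
        eqToHom h₁ ≫ L.φAn.map (L.κAn.functor.map ((L.lamOver vc νc).hom.app x)) ≫ L.ηAn.hom.app x ≫ eqToHom h₂ := by
  have e₁ : ((L.anTelecoreDiagram anTelJ (fun {a} j => L.telecoreFun a.1 j)).pathFunctor
      (betaCorePath anTelJ vc νc hνc jc)).obj x =
      L.φAn.obj (L.κAn.functor.obj ((L.lam vc νc ⋙ L.forget vc ⋙ L.toE vc).obj x)) := by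
    simp only [betaCorePath, descendPath, pathFunctor_cons, pathFunctor_nil]; rfl
  have e₂ : ((L.anTelecoreDiagram anTelJ (fun {a} j => L.telecoreFun a.1 j)).pathFunctor
      (Path.nil : Path ((anTelecoreShape anTelJ).base ⟨.core, core_mem_five⟩) _)).obj x = x :=
    Functor.congr_obj ((L.anTelecoreDiagram anTelJ (fun {a} j => L.telecoreFun a.1 j)).pathFunctor_nil
      ((anTelecoreShape anTelJ).base ⟨.core, core_mem_five⟩)) x
  refine ⟨e₁, e₂.symm, ?_⟩
  rw [L.contactFamily_η_eq_lift vc νc hνc vr νr hνr (w := (anTelecoreShape anTelJ).base ⟨.core, core_mem_five⟩) trivial]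
  have key : ((L.contactOver).lift (L.contactFF ((anTelecoreShape anTelJ).base ⟨.core, core_mem_five⟩) trivial)
      (betaCorePath anTelJ vc νc hνc jc) Path.nil).app x =
      ((L.contactOver).pathIso (betaCorePath anTelJ vc νc hνc jc)).hom.app x ≫
        ((L.contactOver).pathIso (Path.nil : Path ((anTelecoreShape anTelJ).base ⟨.core, core_mem_five⟩) _)).inv.app x :=
    (L.contactOver).map_lift_app (L.contactFF ((anTelecoreShape anTelJ).base ⟨.core, core_mem_five⟩) trivial)
      (betaCorePath anTelJ vc νc hνc jc) Path.nil x
  rw [key]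
  have H : ((L.contactOver).pathIso (betaCorePath anTelJ vc νc hνc jc)).hom.app x ≫
      ((L.contactOver).pathIso (Path.nil : Path ((anTelecoreShape anTelJ).base ⟨.core, core_mem_five⟩) _)).inv.app x ≍
      L.φAn.map (L.κAn.functor.map ((L.lamOver vc νc).hom.app x)) ≫ L.ηAn.hom.app x := by
    refine HEq.trans ?_ (heq_of_eq (Category.comp_id _))
    exact heq_comp e₁ rfl e₂ (L.pathIso_betaCore_heq vc νc hνc jc x)
        (L.pathIso_nil_inv_heq (w := (anTelecoreShape anTelJ).base ⟨.core, core_mem_five⟩) x)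
  exact ((conj_eqToHom_iff_heq _ _ e₁ e₂).2 H).trans (congrArg (fun t => eqToHom e₁ ≫ t) (Category.assoc _ _ _))

/-- **`η_⋎` arises from `η_{An•}`**: the homotopy of `ℋ_{An•}` on the generator `([β¹_⋎], [β⁰_⋎])` is, componentwise,
`φ_{An•}(κ_{An•}(λ⊞_{v,ν} lies over Th•[Z])) ≫ η_{An•}`. [cite: MochizukiAbsTopIII2015, Cor 5.5 (ii) p.131] -/
theorem contactFamily_etaRow (n : ℤ) (jn : anTelJ (isArc := isArc) ⟨.row1 n, row1_mem_five n⟩)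
    (h : (L.contactFamily vc νc hνc vr νr hνr).E (betaRowPath anTelJ n (vr n) (νr n) (hνr n) jn) Path.nil) (x : L.X) :
    ∃ (h₁ : ((L.anTelecoreDiagram anTelJ (fun {a} j => L.telecoreFun a.1 j)).pathFunctor
          (betaRowPath anTelJ n (vr n) (νr n) (hνr n) jn)).obj x =
          L.φAn.obj (L.κAn.functor.obj ((L.lam (vr n) (νr n) ⋙ L.forget (vr n) ⋙ L.toE (vr n)).obj x)))
      (h₂ : x = ((L.anTelecoreDiagram anTelJ (fun {a} j => L.telecoreFun a.1 j)).pathFunctor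
          (Path.nil : Path ((anTelecoreShape anTelJ).base ⟨.row1 n, row1_mem_five n⟩) _)).obj x),
      ((L.contactFamily vc νc hνc vr νr hνr).η h).app x =
        eqToHom h₁ ≫ L.φAn.map (L.κAn.functor.map ((L.lamOver (vr n) (νr n)).hom.app x)) ≫ L.ηAn.hom.app x ≫
          eqToHom h₂ := by
  have e₁ : ((L.anTelecoreDiagram anTelJ (fun {a} j => L.telecoreFun a.1 j)).pathFunctor
      (betaRowPath anTelJ n (vr n) (νr n) (hνr n) jn)).obj x =
      L.φAn.obj (L.κAn.functor.obj ((L.lam (vr n) (νr n) ⋙ L.forget (vr n) ⋙ L.toE (vr n)).obj x)) := by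
    rw [betaRowPath_eq]
    simp only [pathFunctor_cons, pathFunctor_nil]; rfl
  have e₂ : ((L.anTelecoreDiagram anTelJ (fun {a} j => L.telecoreFun a.1 j)).pathFunctor
      (Path.nil : Path ((anTelecoreShape anTelJ).base ⟨.row1 n, row1_mem_five n⟩) _)).obj x = x :=
    Functor.congr_obj ((L.anTelecoreDiagram anTelJ (fun {a} j => L.telecoreFun a.1 j)).pathFunctor_nil
      ((anTelecoreShape anTelJ).base ⟨.row1 n, row1_mem_five n⟩)) x
  refine ⟨e₁, e₂.symm, ?_⟩
  rw [L.contactFamily_η_eq_lift vc νc hνc vr νr hνr (w := (anTelecoreShape anTelJ).base ⟨.row1 n, row1_mem_five n⟩)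
    trivial]
  have key : ((L.contactOver).lift (L.contactFF ((anTelecoreShape anTelJ).base ⟨.row1 n, row1_mem_five n⟩) trivial)
      (betaRowPath anTelJ n (vr n) (νr n) (hνr n) jn) Path.nil).app x =
      ((L.contactOver).pathIso (betaRowPath anTelJ n (vr n) (νr n) (hνr n) jn)).hom.app x ≫
        ((L.contactOver).pathIso
          (Path.nil : Path ((anTelecoreShape anTelJ).base ⟨.row1 n, row1_mem_five n⟩) _)).inv.app x :=
    (L.contactOver).map_lift_app (L.contactFF ((anTelecoreShape anTelJ).base ⟨.row1 n, row1_mem_five n⟩) trivial)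
      (betaRowPath anTelJ n (vr n) (νr n) (hνr n) jn) Path.nil x
  rw [key]
  have H : ((L.contactOver).pathIso (betaRowPath anTelJ n (vr n) (νr n) (hνr n) jn)).hom.app x ≫
      ((L.contactOver).pathIso
        (Path.nil : Path ((anTelecoreShape anTelJ).base ⟨.row1 n, row1_mem_five n⟩) _)).inv.app x ≍
      L.φAn.map (L.κAn.functor.map ((L.lamOver (vr n) (νr n)).hom.app x)) ≫ L.ηAn.hom.app x := by
    refine HEq.trans ?_ (heq_of_eq (Category.comp_id _))
    exact heq_comp e₁ rfl e₂ (L.pathIso_betaRow_heq vr νr hνr n jn x)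
        (L.pathIso_nil_inv_heq (w := (anTelecoreShape anTelJ).base ⟨.row1 n, row1_mem_five n⟩) x)
  exact ((conj_eqToHom_iff_heq _ _ e₁ e₂).2 H).trans (congrArg (fun t => eqToHom e₁ ≫ t) (Category.assoc _ _ _))

end Generators

/-! ## Cor 5.5 (ii) with the contact structure pinned: the theorem -/

section Holds

variable [Nonempty Vmod]

/-- **The telecore `𝔗_{An•}`** on `D•_{≤5}` over the core `An•[𝒳]` determined by the structure functors over `𝒳`:
telecore edges `φ_⋏ = φ_{An•}`, `⋏ ∈ L ∪ {□}`, family `𝒥` = the universal family on the pairs `([γ₃]∘[γ₁], [γ₃]∘[γ₂])`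
(t5's `univTelecore`; `V(F_mod) ≠ ∅` makes every vertex reach `An•[𝒳]`). [cite: MochizukiAbsTopIII2015, Cor 5.5 (ii) p.130] -/
noncomputable def contactTelecore :=
  univTelecore (obsShape InFive .an) (fun _ => (inferInstance : IsEmpty PEmpty.{u + 1})) (L.obsExt InFive .an)
    L.contactBase L.φAn L.contactObsIso L.φAnFullyFaithful anTelJ (fun {a} j => L.telecoreFun a.1 j) L.contactTelIso
    contactW L.contactFF trivial reach_an

/-- `ℋ_{An•}` is a contact structure for `𝔗_{An•}` (compatible with `𝒥`: both are restrictions of `K`).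
[cite: MochizukiAbsTopIII2015, Cor 5.5 (ii) p.131] -/
theorem contactFamily_isContactStructure (vc : Vmod) (νc : LogVertex (isArc vc)) (hνc : νc.isPostLog = false)
    (vr : ℤ → Vmod) (νr : ∀ n, LogVertex (isArc (vr n))) (hνr : ∀ n, (νr n).isPostLog = false) :
    Telecore.IsContactStructure _ (L.contactTelecore) (L.contactFamily vc νc hνc vr νr hνr) :=
  isContactStructure_restrictBoundary _ _ _ _ _ _ _ _ _ _ _ _ _ _ _ _ _

/-- **Cor 5.5 (ii) DISCHARGED with the contact structure PINNED**, for every log-Frobenius setting `L` with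
`V(F_mod) ≠ ∅`: `φ_{An•}` gives a telecore `𝔗_{An•}` on `D•_{≤5}` over the core `An•[𝒳]` of (i), with telecore edges
`φ_⋏ = φ_{An•}` (`⋏ ∈ L ∪ {□}`), and the homotopies `{η_{□⋎}, η_{□⋎}⁻¹, η_⋏, η_⋏⁻¹}` — `η_{□⋎}` the identity, `η_⋏`
arising from `η_{An•}` along a descending path `[β¹_⋏]` (here: through `λ⊞_{v₀, space-link}` at any
`v₀ ∈ V(F_mod)`) — GENERATE a contact structure `ℋ_{An•}` on it. [cite: MochizukiAbsTopIII2015, Cor 5.5 (ii) pp.130–131] -/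
theorem cor55TelecoreContact_holds : L.Cor55TelecoreContact := by
  obtain ⟨v₀⟩ := ‹Nonempty Vmod›
  refine ⟨_, _, univCoreObs_isCore (obsShape InFive .an) (fun _ => (inferInstance : IsEmpty PEmpty.{u + 1}))
      (L.obsExt InFive .an) L.contactBase L.φAn L.contactObsIso L.φAnFullyFaithful reach_an,
    L.contactTelecore, rfl, HEq.rfl,
    L.contactFamily v₀ (LogVertex.spaceLink _) (spaceLink_isPostLog _) (fun _ => v₀)
      (fun _ => LogVertex.spaceLink _) (fun _ => spaceLink_isPostLog _),
    L.contactFamily_isContactStructure _ _ _ _ _ _, ?_⟩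
  exact ⟨v₀, LogVertex.spaceLink _, spaceLink_isPostLog _, fun _ => v₀, fun _ => LogVertex.spaceLink _,
    fun _ => spaceLink_isPostLog _, fun _ _ _ _ => Iff.rfl,
    fun n jc jn hmem A => L.contactFamily_etaSq _ _ _ _ _ _ n jc jn hmem A,
    fun jc hmem X₀ => L.contactFamily_etaCore _ _ _ _ _ _ jc hmem X₀,
    fun n jn hmem X₀ => L.contactFamily_etaRow _ _ _ _ _ _ n jn hmem X₀⟩

omit [Nonempty Vmod] in
/-- The pinned form holds if and only if `V(F_mod) ≠ ∅` (necessity: abc-iut-L4-t15's `not_cor55Telecore_of_isEmpty`).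
[cite: MochizukiAbsTopIII2015, Cor 5.5 (ii) p.130] -/
theorem cor55TelecoreContact_iff_nonempty : L.Cor55TelecoreContact ↔ Nonempty Vmod := by
  refine ⟨fun h => (L.cor55Telecore_iff_nonempty).1 (L.cor55Telecore_of_contact h), fun _ => ?_⟩
  exact L.cor55TelecoreContact_holds

end Holds

end LogFrobeniusSetting

end Literature.AnabelianGeometry.AbsoluteAnabelian
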